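import Summits.ResolutionOfSingularities.ResolutionOfSingularities.Theorems.EquisingularLiftEquisingularLiftNatProjectiveSpaceCoordLineSplitting
import HarnessLib

/-!
# [OURS · L1 W4.5(b) · EL♮(3) · nose residue / NEST centres, brick N-8, part 2/2: sections, charts, ideal, assembly] EVERY COORDINATE LINE `V₊(x₂, …, x_{m+1}) ⊂ ℙ^{m+1}_K` HAS
# UNOBSTRUCTED EMBEDDED DEFORMATIONS: `DirStepUnobs ℙ^{m+1} univ _ Λ` for all `m` (`𝒩 = 𝒪(1)^m`; `m = 1`: a line in the plane)

Cell `res-hironaka`, LADDER-RESOLUTION rung L (D-0089), slot W4.5(b), crux chain w45b: child crux **EL♮(3)** =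
stmt-ResolutionOfSingularities-20148, parent EL♮ = stmt-…-20038. WIDTH seat res-L1-w45b-nose-w1 g2 (D-0157 DOOR 1), free-hand brick N-8
(STATUS 2026-08-28T19:28Z); customers and conventions as in part 1/2.
`--supports stmt-ResolutionOfSingularities-20148 --as helper`.
OURS; NOT a statement of H. Hironaka's 2017 manuscript (nothing of [Hironaka2017] is asserted); AI-written, AI review weaker than expert review.
DEFINITION-FREE (local `notation3` abbreviations only); no `sorry`; standard axioms. EL♮(3) is NOT proved here; resolution in positive characteristic
is NOT proved here (dimension 3 is Cossart–Piltant 2008/2009 in print).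

WHAT (part 2/2; the full proof route is in the module docstring of part 1/2 `…NatProjectiveSpaceCoordLineSplitting`): sections over `D₊(x₀x₁)`
(`map_aTS₀/₁`, `hsplit_basicOpen`), the charts `D₊(x₀)`, `D₊(x₁)` and their quasi-regular chart sections (`isQuasiRegular_gens`), the chart ideals
(`ker_kill_eq_span`, `span_gens_eq`), the coordinate line `Λ = V₊(x₂, …, x_{m+1})` (`isClosed_coordLine`, `coordLine_subset_union`, NEW for all `m`:
`range_projMap_kill_eq_coordLine`, `ker_projMap_kill_eq_vanishingIdeal_coordLine`), and the assembly ★★ `PnLine.dirStepUnobs_coordLine (K) (m) :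
DirStepUnobs (Proj K[x₀,…,x_{m+1}]) Set.univ isClosed_univ Λ _` through ✓ p655133 `dirStepUnobs_univ_of_two_charts`.

References (method / index only): R. Hartshorne, *Algebraic Geometry* (1977), II Prop. 2.5, II Prop. 5.11 (proof), II Ex. 3.12, III Thm. 5.1
[cite: Hartshorne1977]; The Stacks Project, Tag 01ED [cite: StacksProject].
-/

set_option linter.dupNamespace false -- mandated namespace `Summit.<Summit>.<Problem>` of this single-conjunct summit

noncomputable section

-- `TopCat.Presheaf`/`Scheme.Modules` are not reducible (as in Mathlib's `AlgebraicGeometry/Modules`).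
set_option backward.isDefEq.respectTransparency false

open CategoryTheory CategoryTheory.Limits AlgebraicGeometry TopologicalSpace Opposite
open MvPolynomial HomogeneousLocalization
open Literature.AlgebraicGeometry.Resolution
open Literature.AlgebraicGeometry.Motives

namespace Summit.ResolutionOfSingularities.ResolutionOfSingularities.Cruxes.EquisingularLiftNat.Sections

namespace PnLine

variable (K : Type) [Field K] (m : ℕ)

attribute [local instance] MvPolynomial.gradedAlgebra ProjBaseChange.algebraBase

local notation "𝒜" => MvPolynomial.homogeneousSubmodule (Fin (1 + m + 1)) K
local notation "A4" => MvPolynomial (Fin (1 + m + 1)) K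

/-! Local abbreviations as in part 1/2 (notation only; the file stays definition-free). -/
local notation3 "res₀" => HomogeneousLocalization.awayMap (MvPolynomial.homogeneousSubmodule (Fin (1 + m + 1)) K) (ProjectiveSpace.X_mem (R := K) (1 : Fin (1 + m + 1)))
  (rfl : (X 0 * X 1 : MvPolynomial (Fin (1 + m + 1)) K) = X 0 * X 1)
local notation3 "res₁" => HomogeneousLocalization.awayMap (MvPolynomial.homogeneousSubmodule (Fin (1 + m + 1)) K) (ProjectiveSpace.X_mem (R := K) (0 : Fin (1 + m + 1)))
  (mul_comm (X 0 : MvPolynomial (Fin (1 + m + 1)) K) (X 1))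
local notation3 "tEl" => HomogeneousLocalization.Away.mk (MvPolynomial.homogeneousSubmodule (Fin (1 + m + 1)) K) (X01_mem K m) 1 (X 1 ^ 2 : MvPolynomial (Fin (1 + m + 1)) K) (X_one_sq_mem K m)
local notation3 "aTS[" s "]" => CommRingCat.Hom.hom (Proj.awayToSection (MvPolynomial.homogeneousSubmodule (Fin (1 + m + 1)) K) s)
local notation3 "U[" i "]" => ProjSubscheme.affineBasicOpen (MvPolynomial.homogeneousSubmodule (Fin (1 + m + 1)) K) (X i : MvPolynomial (Fin (1 + m + 1)) K)
  (ProjectiveSpace.X_mem (R := K) i) one_pos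
local notation3 "gens[" i "]" => fun k : Fin m =>
  CommRingCat.Hom.hom (Proj.awayToSection (MvPolynomial.homogeneousSubmodule (Fin (1 + m + 1)) K) (X i : MvPolynomial (Fin (1 + m + 1)) K)) (ProjectiveSpace.chartGen K i (⟨(k : ℕ) + 1, by omega⟩ : Fin (1 + m)))
local notation3 "kerKill[" f "]" => RingHom.ker (R := MvPolynomial (Fin (1 + m + 1)) K) (S := MvPolynomial (Fin (1 + 1)) K) f

/-- Restriction from `D₊(x₀)` to `D₊(x₀x₁)` is `res₀` on fractions. -/
theorem map_aTS₀ (h : Proj.basicOpen 𝒜 (X 0 * X 1 : MvPolynomial (Fin (1 + m + 1)) K) ≤ Proj.basicOpen 𝒜 (X 0)) (a : Away 𝒜 (X 0 : A4)) :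
    (Proj 𝒜).presheaf.map (homOfLE h).op (aTS[(X 0 : A4)] a) = aTS[(X 0 * X 1 : A4)] (res₀ a) := by
  have e := ConcreteCategory.congr_hom
    (Proj.awayMap_awayToSection 𝒜 (f := (X 0 : A4)) (ProjectiveSpace.X_mem (R := K) 1) (x := X 0 * X 1) rfl) a
  exact e.symm

/-- Restriction from `D₊(x₁)` to `D₊(x₀x₁)` is `res₁` on fractions. -/
theorem map_aTS₁ (h : Proj.basicOpen 𝒜 (X 0 * X 1 : MvPolynomial (Fin (1 + m + 1)) K) ≤ Proj.basicOpen 𝒜 (X 1)) (b : Away 𝒜 (X 1 : A4)) :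
    (Proj 𝒜).presheaf.map (homOfLE h).op (aTS[(X 1 : A4)] b) = aTS[(X 0 * X 1 : A4)] (res₁ b) := by
  have e := ConcreteCategory.congr_hom
    (Proj.awayMap_awayToSection 𝒜 (f := (X 1 : A4)) (ProjectiveSpace.X_mem (R := K) 0) (x := X 0 * X 1) (mul_comm _ _)) b
  exact e.symm

/-- `res₀ (x₁/x₀) = t`. -/
theorem res₀_chartGen_zero : res₀ (ProjectiveSpace.chartGen K (0 : Fin (1 + m + 1)) 0) = tEl := by
  rw [ProjectiveSpace.chartGen, awayMap_mk]
  apply HomogeneousLocalization.val_injective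
  simp only [HomogeneousLocalization.Away.val_mk]
  exact Localization.mk_eq_mk_iff.mpr (Localization.r_of_eq (by simp; ring))

/-- `0⁺(k+1) = k+2` and `1⁺(k+1) = k+2` (`⁺ = succAbove`). -/
theorem succAbove_succ_eq (k : Fin m) :
    (0 : Fin (1 + m + 1)).succAbove (⟨(k : ℕ) + 1, by omega⟩ : Fin (1 + m)) = (⟨(k : ℕ) + 2, by omega⟩ : Fin (1 + m + 1)) ∧
      (1 : Fin (1 + m + 1)).succAbove (⟨(k : ℕ) + 1, by omega⟩ : Fin (1 + m)) = (⟨(k : ℕ) + 2, by omega⟩ : Fin (1 + m + 1)) := by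
  constructor
  · rw [Fin.succAbove_of_le_castSucc _ _ (Fin.zero_le _)]
    exact Fin.ext (by simp only [Fin.val_succ])
  · rw [Fin.succAbove_of_le_castSucc _ _ (by rw [Fin.le_iff_val_le_val]; simp [Nat.mod_eq_of_lt (show 1 < 1 + m + 1 by omega)])]
    exact Fin.ext (by simp only [Fin.val_succ])

/-- The transition of generators: `x_{k+2}/x₀ = (x₁/x₀)·(x_{k+2}/x₁)` on the overlap. -/
theorem res₀_chartGen_succ (k : Fin m) :
    res₀ (ProjectiveSpace.chartGen K 0 (⟨(k : ℕ) + 1, by omega⟩ : Fin (1 + m))) = tEl * res₁ (ProjectiveSpace.chartGen K 1 (⟨(k : ℕ) + 1, by omega⟩ : Fin (1 + m))) := by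
  rw [ProjectiveSpace.chartGen, ProjectiveSpace.chartGen, awayMap_mk, awayMap_mk,
    Literature.AlgebraicGeometry.Resolution.Away.mk_mul_mk]
  apply HomogeneousLocalization.val_injective
  simp only [HomogeneousLocalization.Away.val_mk, (succAbove_succ_eq m k).1, (succAbove_succ_eq m k).2]
  refine Localization.mk_eq_mk_iff.mpr (Localization.r_of_eq ?_)
  simp
  ring

section KillSections

variable (fk : MvPolynomial.homogeneousSubmodule (Fin (1 + m + 1)) K →+*ᵍ MvPolynomial.homogeneousSubmodule (Fin (1 + 1)) K)
  (hfk' : HomogeneousIdeal.irrelevant (MvPolynomial.homogeneousSubmodule (Fin (1 + 1)) K) ≤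
    (HomogeneousIdeal.irrelevant (MvPolynomial.homogeneousSubmodule (Fin (1 + m + 1)) K)).map fk)
  (hfkC : ∀ a : K, fk (C a) = C a)
  (hfkX : ∀ i : Fin (1 + m + 1), fk (X i) = if h : (i : ℕ) < 1 + 1 then X ⟨i, h⟩ else 0)

include hfkC hfkX in
/-- ★ **Twisted splitting of sections over `D₊(x₀x₁)` modulo the ideal sheaf of the line** (sections form of `exists_split`). -/
theorem hsplit_basicOpen
    (h0 : Proj.basicOpen 𝒜 (X 0 * X 1 : A4) ≤ Proj.basicOpen 𝒜 (X 0)) (h1 : Proj.basicOpen 𝒜 (X 0 * X 1 : A4) ≤ Proj.basicOpen 𝒜 (X 1))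
    (c : Fin m → Γ(Proj 𝒜, Proj.basicOpen 𝒜 (X 0 * X 1 : A4))) :
    ∃ (a : Fin m → Γ(Proj 𝒜, Proj.basicOpen 𝒜 (X 0 : A4))) (b : Fin m → Γ(Proj 𝒜, Proj.basicOpen 𝒜 (X 1 : A4))), ∀ k,
      c k - ((Proj 𝒜).presheaf.map (homOfLE h0).op (a k) +
        ∑ j, (if k = j then (Proj 𝒜).presheaf.map (homOfLE h0).op (aTS[(X 0 : A4)] (ProjectiveSpace.chartGen K 0 0)) else 0) *
          (Proj 𝒜).presheaf.map (homOfLE h1).op (b j)) ∈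
        (Proj.map fk hfk').ker.ideal ⟨Proj.basicOpen 𝒜 (X 0 * X 1 : A4), Proj.isAffineOpen_basicOpen 𝒜 _ (X01_mem K m) two_pos⟩ := by
  classical
  have hsurj : Function.Surjective fk :=
    EquisingularLift.StrataSplit.LinearCentre.kill_surjective (r := 1) (m := m) fk.toRingHom (fun a => hfkC a) (fun i => hfkX i)
  have hbij : Function.Bijective (aTS[(X 0 * X 1 : A4)]) :=
    ConcreteCategory.bijective_of_isIso (Proj.basicOpenIsoAway 𝒜 (X 0 * X 1 : A4) (X01_mem K m) two_pos).hom
  choose z hz using fun k => hbij.2 (c k)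
  choose a b hab using fun k => exists_split K m fk hfkX (z k)
  refine ⟨fun k => aTS[(X 0 : A4)] (a k), fun k => aTS[(X 1 : A4)] (b k), fun k => ?_⟩
  have hJ : (Proj.map fk hfk').ker.ideal ⟨Proj.basicOpen 𝒜 (X 0 * X 1 : A4), Proj.isAffineOpen_basicOpen 𝒜 _ (X01_mem K m) two_pos⟩ =
      (awayIdeal 𝒜 (X01_mem K m) (kerKill[fk])).map (aTS[(X 0 * X 1 : A4)]) :=
    ker_projMap_ideal_basicOpen fk hfk' hsurj two_pos (X01_mem K m)
  rw [hJ]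
  simp only [ite_mul, zero_mul, Finset.sum_ite_eq, Finset.mem_univ, if_true]
  have e1 : (Proj 𝒜).presheaf.map (homOfLE h0).op (aTS[(X 0 : A4)] (a k)) = aTS[(X 0 * X 1 : A4)] (res₀ (a k)) := map_aTS₀ K m h0 (a k)
  have e2 : (Proj 𝒜).presheaf.map (homOfLE h1).op (aTS[(X 1 : A4)] (b k)) = aTS[(X 0 * X 1 : A4)] (res₁ (b k)) := map_aTS₁ K m h1 (b k)
  have e3 : (Proj 𝒜).presheaf.map (homOfLE h0).op (aTS[(X 0 : A4)] (ProjectiveSpace.chartGen K 0 0)) = aTS[(X 0 * X 1 : A4)] (tEl) := by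
    rw [map_aTS₀, res₀_chartGen_zero]
  rw [← hz k, e1, e2, e3]
  have hmem := Ideal.mem_map_of_mem (aTS[(X 0 * X 1 : A4)]) (hab k)
  rw [map_sub, map_add, map_mul] at hmem
  exact hmem

end KillSections

/-- `D₊(x₀) ∩ D₊(x₁) = D₊(x₀x₁)` is affine. -/
theorem isAffineOpen_inf : IsAffineOpen (((U[(0 : Fin (1 + m + 1))]) : (Proj 𝒜).Opens) ⊓ U[1]) := by
  rw [ProjSubscheme.affineBasicOpen_coe, ProjSubscheme.affineBasicOpen_coe, ← Proj.basicOpen_mul]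
  exact Proj.isAffineOpen_basicOpen 𝒜 _ (X01_mem K m) two_pos

/-- `(y₁, …, y_m)` is a quasi-regular sequence in `K[y₀, …, y_m]`. -/
theorem isQuasiRegular_X_succ : IsQuasiRegular (fun k : Fin m => (X (⟨(k : ℕ) + 1, by omega⟩ : Fin (1 + m)) : MvPolynomial (Fin (1 + m)) K)) := by
  refine isQuasiRegular_of_isWeaklyRegular _ ?_
  have hl : List.ofFn (fun k : Fin m => (X (⟨(k : ℕ) + 1, by omega⟩ : Fin (1 + m)) : MvPolynomial (Fin (1 + m)) K)) =
      (List.ofFn (fun k : Fin m => (⟨(k : ℕ) + 1, by omega⟩ : Fin (1 + m)))).map X := by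
    rw [List.map_ofFn]; rfl
  rw [hl]
  refine Literature.AlgebraicGeometry.Resolution.MvPolynomial.isWeaklyRegular_map_X (R := K) _ (List.nodup_ofFn.mpr ?_)
  intro a b hab
  exact Fin.ext (by simpa using congrArg Fin.val hab)

/-- The chart sections `(x_{i⁺(k+1)}/xᵢ)_k` are quasi-regular in `Γ(ℙ^{m+1}, D₊(xᵢ))` (transport of `(y₁, …, y_m)` along the chart iso). -/
theorem isQuasiRegular_gens (i : Fin (1 + m + 1)) : IsQuasiRegular (gens[i]) := by
  let e : MvPolynomial (Fin (1 + m)) K ≃+* Γ(Proj 𝒜, ((U[i]) : (Proj 𝒜).Opens)) :=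
    (ProjectiveSpace.chartAlgEquiv K i).symm.toRingEquiv.trans
      (Proj.basicOpenIsoAway 𝒜 (X i : A4) (ProjectiveSpace.X_mem (R := K) i) one_pos).commRingCatIsoToRingEquiv
  have h := (isQuasiRegular_X_succ K m).map_ringEquiv e
  have hfun : (e ∘ (fun k : Fin m => (X (⟨(k : ℕ) + 1, by omega⟩ : Fin (1 + m)) : MvPolynomial (Fin (1 + m)) K))) = gens[i] := by
    funext k
    simp only [Function.comp_apply, e, RingEquiv.coe_trans, Function.comp_apply,
      AlgEquiv.coe_ringEquiv, ProjectiveSpace.chartAlgEquiv_symm_X]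
    rfl
  rwa [hfun] at h

section Assembly

variable (fk : MvPolynomial.homogeneousSubmodule (Fin (1 + m + 1)) K →+*ᵍ MvPolynomial.homogeneousSubmodule (Fin (1 + 1)) K)
  (hfk' : HomogeneousIdeal.irrelevant (MvPolynomial.homogeneousSubmodule (Fin (1 + 1)) K) ≤
    (HomogeneousIdeal.irrelevant (MvPolynomial.homogeneousSubmodule (Fin (1 + m + 1)) K)).map fk)
  (hfkC : ∀ a : K, fk (C a) = C a)
  (hfkX : ∀ i : Fin (1 + m + 1), fk (X i) = if h : (i : ℕ) < 1 + 1 then X ⟨i, h⟩ else 0)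

include hfkC hfkX in
/-- `ker f_K = (x₂, …, x_{m+1})` in generator form. -/
theorem ker_kill_eq_span : kerKill[fk] = Ideal.span (Set.range (fun k : Fin m => (X (⟨(k : ℕ) + 2, by omega⟩ : Fin (1 + m + 1)) : A4))) := by
  have h := EquisingularLift.StrataSplit.LinearCentre.ker_kill (r := 1) (m := m) fk.toRingHom (fun a => hfkC a) (fun i => hfkX i)
  change RingHom.ker fk.toRingHom = _ at h
  rw [show RingHom.ker (R := A4) (S := MvPolynomial (Fin (1 + 1)) K) fk = RingHom.ker fk.toRingHom from rfl, h]
  congr 1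
  ext p
  simp only [Set.mem_image, Set.mem_setOf_eq, Set.mem_range]
  constructor
  · rintro ⟨i, hi, rfl⟩
    refine ⟨⟨(i : ℕ) - 2, by omega⟩, ?_⟩
    congr 1
    ext; simp; omega
  · rintro ⟨k, rfl⟩
    exact ⟨_, by simp, rfl⟩

include hfkC hfkX in
/-- The ideal of the line on the chart `D₊(xᵢ)` is generated by `(x₂/xᵢ, …, x_{m+1}/xᵢ)` when `i⁺(k+1) = k+2` (`i = 0, 1`). -/
theorem span_gens_eq (i : Fin (1 + m + 1)) (hi : ∀ k : Fin m, i.succAbove (⟨(k : ℕ) + 1, by omega⟩ : Fin (1 + m)) = (⟨(k : ℕ) + 2, by omega⟩ : Fin (1 + m + 1))) :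
    Ideal.span (Set.range (gens[i])) = (Proj.map fk hfk').ker.ideal (U[i]) := by
  have hsurj : Function.Surjective fk :=
    EquisingularLift.StrataSplit.LinearCentre.kill_surjective (r := 1) (m := m) fk.toRingHom (fun a => hfkC a) (fun i => hfkX i)
  have hJ : (Proj.map fk hfk').ker.ideal (U[i]) = (awayIdeal 𝒜 (ProjectiveSpace.X_mem (R := K) i) (kerKill[fk])).map (aTS[(X i : A4)]) :=
    ker_projMap_ideal_basicOpen fk hfk' hsurj one_pos (ProjectiveSpace.X_mem (R := K) i)
  rw [hJ, ker_kill_eq_span K m fk hfkC hfkX,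
    awayIdeal_span_eq 𝒜 (ProjectiveSpace.X_mem (R := K) i) _ (fun _ => 1) (fun k => by simpa using ProjectiveSpace.X_mem (R := K) _),
    Ideal.map_span, ← Set.range_comp]
  refine congrArg (fun f => Ideal.span (Set.range f)) (funext fun k => ?_)
  simp only [Function.comp_apply, ProjectiveSpace.chartGen, hi k]
  rfl

end Assembly

section Final

variable (fk : MvPolynomial.homogeneousSubmodule (Fin (1 + m + 1)) K →+*ᵍ MvPolynomial.homogeneousSubmodule (Fin (1 + 1)) K)
  (hfk' : HomogeneousIdeal.irrelevant (MvPolynomial.homogeneousSubmodule (Fin (1 + 1)) K) ≤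
    (HomogeneousIdeal.irrelevant (MvPolynomial.homogeneousSubmodule (Fin (1 + m + 1)) K)).map fk)
  (hfkC : ∀ a : K, fk (C a) = C a)
  (hfkX : ∀ i : Fin (1 + m + 1), fk (X i) = if h : (i : ℕ) < 1 + 1 then X ⟨i, h⟩ else 0)

/-- The transition of the chart generators on sections over `D₊(x₀x₁)`: `(x_{k+2}/x₀)| = (x₁/x₀)| · (x_{k+2}/x₁)|`. -/
theorem hM_basicOpen (h0 : Proj.basicOpen 𝒜 (X 0 * X 1 : A4) ≤ Proj.basicOpen 𝒜 (X 0))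
    (h1 : Proj.basicOpen 𝒜 (X 0 * X 1 : A4) ≤ Proj.basicOpen 𝒜 (X 1)) (k : Fin m) :
    (Proj 𝒜).presheaf.map (homOfLE h0).op (gens[0] k) =
      ∑ j, (if k = j then (Proj 𝒜).presheaf.map (homOfLE h0).op (aTS[(X 0 : A4)] (ProjectiveSpace.chartGen K 0 0)) else 0) *
        (Proj 𝒜).presheaf.map (homOfLE h1).op (gens[1] j) := by
  classical
  simp only [ite_mul, zero_mul, Finset.sum_ite_eq, Finset.mem_univ, if_true]
  change (Proj 𝒜).presheaf.map (homOfLE h0).op (aTS[(X 0 : A4)] (ProjectiveSpace.chartGen K 0 (⟨(k : ℕ) + 1, by omega⟩ : Fin (1 + m)))) =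
    (Proj 𝒜).presheaf.map (homOfLE h0).op (aTS[(X 0 : A4)] (ProjectiveSpace.chartGen K 0 0)) *
      (Proj 𝒜).presheaf.map (homOfLE h1).op (aTS[(X 1 : A4)] (ProjectiveSpace.chartGen K 1 (⟨(k : ℕ) + 1, by omega⟩ : Fin (1 + m))))
  rw [map_aTS₀, map_aTS₀, map_aTS₁, res₀_chartGen_succ, res₀_chartGen_zero, map_mul]

include hfkC hfkX in
/-- Transport of `hM_basicOpen` / `hsplit_basicOpen` to any open EQUAL to `D₊(x₀x₁)` (used with `D₊(x₀) ⊓ D₊(x₁)`). -/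
theorem transport_of_eq {V : (Proj 𝒜).Opens} (hV : V = Proj.basicOpen 𝒜 (X 0 * X 1 : A4)) (hVaff : IsAffineOpen V)
    (h0 : V ≤ Proj.basicOpen 𝒜 (X 0)) (h1 : V ≤ Proj.basicOpen 𝒜 (X 1)) :
    (∀ k : Fin m, (Proj 𝒜).presheaf.map (homOfLE h0).op (gens[0] k) =
      ∑ j, (if k = j then (Proj 𝒜).presheaf.map (homOfLE h0).op (aTS[(X 0 : A4)] (ProjectiveSpace.chartGen K 0 0)) else 0) *
        (Proj 𝒜).presheaf.map (homOfLE h1).op (gens[1] j)) ∧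
    (∀ c : Fin m → Γ(Proj 𝒜, V), ∃ (a : Fin m → Γ(Proj 𝒜, Proj.basicOpen 𝒜 (X 0 : A4))) (b : Fin m → Γ(Proj 𝒜, Proj.basicOpen 𝒜 (X 1 : A4))),
      ∀ k, c k - ((Proj 𝒜).presheaf.map (homOfLE h0).op (a k) +
        ∑ j, (if k = j then (Proj 𝒜).presheaf.map (homOfLE h0).op (aTS[(X 0 : A4)] (ProjectiveSpace.chartGen K 0 0)) else 0) *
          (Proj 𝒜).presheaf.map (homOfLE h1).op (b j)) ∈ (Proj.map fk hfk').ker.ideal ⟨V, hVaff⟩) := by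
  subst hV
  exact ⟨hM_basicOpen K m h0 h1, hsplit_basicOpen K m fk hfk' hfkC hfkX h0 h1⟩

end Final

/-- The coordinate line is a zero locus, hence closed. [cite: Hartshorne1977, II Prop. 2.5] (folklore) -/
theorem isClosed_coordLine :
    IsClosed {y : Proj 𝒜 | ∀ k : Fin m, (X (⟨(k : ℕ) + 2, by omega⟩ : Fin (1 + m + 1)) : A4) ∈ y.asHomogeneousIdeal} := by
  have h : {y : Proj 𝒜 | ∀ k : Fin m, (X (⟨(k : ℕ) + 2, by omega⟩ : Fin (1 + m + 1)) : A4) ∈ y.asHomogeneousIdeal} =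
      ⋂ k : Fin m, ((Proj.basicOpen 𝒜 (X (⟨(k : ℕ) + 2, by omega⟩ : Fin (1 + m + 1)) : A4) : (Proj 𝒜).Opens) : Set (Proj 𝒜))ᶜ := by
    ext y
    simp only [Set.mem_setOf_eq, Set.mem_iInter, Set.mem_compl_iff, SetLike.mem_coe, Proj.mem_basicOpen, not_not]
  rw [h]
  exact isClosed_iInter fun k => (Proj.basicOpen 𝒜 (X (⟨(k : ℕ) + 2, by omega⟩ : Fin (1 + m + 1)) : A4)).isOpen.isClosed_compl

/-- The coordinate line is covered by the two charts `D₊(x₀)`, `D₊(x₁)` (a relevant prime containing `x₂, …, x_{m+1}` misses `x₀` or `x₁`).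
[cite: Hartshorne1977, II Prop. 2.5 (proof)] (folklore) -/
theorem coordLine_subset_union :
    {y : Proj 𝒜 | ∀ k : Fin m, (X (⟨(k : ℕ) + 2, by omega⟩ : Fin (1 + m + 1)) : A4) ∈ y.asHomogeneousIdeal} ⊆
      (((U[0]) : (Proj 𝒜).Opens) : Set (Proj 𝒜)) ∪ (((U[1]) : (Proj 𝒜).Opens) : Set (Proj 𝒜)) := by
  intro y hy
  by_contra h
  simp only [Set.mem_union, SetLike.mem_coe, not_or] at h
  have h0 : (X 0 : A4) ∈ y.asHomogeneousIdeal := by simpa [Proj.mem_basicOpen] using h.1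
  have h1 : (X 1 : A4) ∈ y.asHomogeneousIdeal := by simpa [Proj.mem_basicOpen] using h.2
  apply y.not_irrelevant_le
  intro p hp
  have hp' := ProjectiveSpace.irrelevant_le_span (1 + m) K hp
  refine (Ideal.span_le.mpr ?_) hp'
  rintro _ ⟨i, rfl⟩
  rcases fin_cases_two m i with rfl | rfl | ⟨k, rfl⟩
  · exact h0
  · exact h1
  · exact hy k

section KillIdeal

variable (fk : MvPolynomial.homogeneousSubmodule (Fin (1 + m + 1)) K →+*ᵍ MvPolynomial.homogeneousSubmodule (Fin (1 + 1)) K)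
  (hfk' : HomogeneousIdeal.irrelevant (MvPolynomial.homogeneousSubmodule (Fin (1 + 1)) K) ≤
    (HomogeneousIdeal.irrelevant (MvPolynomial.homogeneousSubmodule (Fin (1 + m + 1)) K)).map fk)
  (hfkC : ∀ a : K, fk (C a) = C a)
  (hfkX : ∀ i : Fin (1 + m + 1), fk (X i) = if h : (i : ℕ) < 1 + 1 then X ⟨i, h⟩ else 0)

/-- The indices `≥ 2` as a finset, and that it is proper. -/
theorem filter_two_le_ne_univ : (Finset.univ.filter fun i : Fin (1 + m + 1) => 1 + 1 ≤ (i : ℕ)) ≠ Finset.univ := by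
  intro h
  have h0 : (0 : Fin (1 + m + 1)) ∈ Finset.univ.filter (fun i : Fin (1 + m + 1) => 1 + 1 ≤ (i : ℕ)) := by
    rw [h]; exact Finset.mem_univ _
  simp at h0

include hfkC hfkX in
/-- **The range of the kill-map immersion `Proj(f_K) : ℙ¹ ↪ ℙ^{m+1}` is the coordinate line** (⊆: `f_K(x_{k+2}) = 0`; ⊇: the line is the
closure of its generic point `(x₂, …, x_{m+1})` = the image of the generic point of `ℙ¹`, and the range is closed).
[cite: Hartshorne1977, II Ex. 3.12] (folklore) -/
theorem range_projMap_kill_eq_coordLine :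
    Set.range (Proj.map fk hfk') = {y : Proj 𝒜 | ∀ k : Fin m, (X (⟨(k : ℕ) + 2, by omega⟩ : Fin (1 + m + 1)) : A4) ∈ y.asHomogeneousIdeal} := by
  classical
  have hsurj : Function.Surjective fk :=
    EquisingularLift.StrataSplit.LinearCentre.kill_surjective (r := 1) (m := m) fk.toRingHom (fun a => hfkC a) (fun i => hfkX i)
  haveI : IsClosedImmersion (Proj.map fk hfk') :=
    Literature.AlgebraicGeometry.FundamentalGroup.isClosedImmersion_projMap_of_surjective fk hfk' hsurj
  refine Set.Subset.antisymm ?_ ?_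
  · rintro _ ⟨z, rfl⟩ k
    change (X (⟨(k : ℕ) + 2, by omega⟩ : Fin (1 + m + 1)) : A4) ∈ ((Proj.map fk hfk') z).asHomogeneousIdeal
    rw [EquisingularLiftNat.LinearCentre.projMap_apply_asHomogeneousIdeal]
    change fk (X (⟨(k : ℕ) + 2, by omega⟩ : Fin (1 + m + 1))) ∈ z.asHomogeneousIdeal
    rw [hfkX, dif_neg (by simp)]
    exact zero_mem _
  · -- the line is the closure of its generic point, which is the image of the generic point of `ℙ¹`
    set s : Finset (Fin (1 + m + 1)) := Finset.univ.filter fun i : Fin (1 + m + 1) => 1 + 1 ≤ (i : ℕ) with hs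
    have hline : {y : Proj 𝒜 | ∀ k : Fin m, (X (⟨(k : ℕ) + 2, by omega⟩ : Fin (1 + m + 1)) : A4) ∈ y.asHomogeneousIdeal} =
        closure {Literature.AlgebraicGeometry.Motives.coordSubspacePoint (k := K) (N := 1 + m) s (filter_two_le_ne_univ m)} := by
      rw [Literature.AlgebraicGeometry.Motives.closure_coordSubspacePoint]
      ext y
      constructor
      · intro hy
        refine (ProjectiveSpectrum.mem_zeroLocus _ _ _).mpr ?_
        rintro _ ⟨i, hi, rfl⟩
        have hi' : 1 + 1 ≤ (i : ℕ) := by simpa [hs] using hi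
        rcases fin_cases_two m i with rfl | rfl | ⟨k, rfl⟩
        · simp at hi'
        · simp [Nat.mod_eq_of_lt (show 1 < 1 + m + 1 by omega)] at hi'
        · exact hy k
      · intro hy k
        exact (ProjectiveSpectrum.mem_zeroLocus _ _ _).mp hy ⟨_, by simp [hs], rfl⟩
    rw [hline]
    refine closure_minimal (Set.singleton_subset_iff.mpr ?_) (Proj.map fk hfk').isClosedEmbedding.isClosed_range
    -- the generic point of `ℙ¹`
    let y₀ : Proj (MvPolynomial.homogeneousSubmodule (Fin (1 + 1)) K) :=
      ⟨⊥, Ideal.isPrime_bot, fun h => by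
        have hX : (X 0 : MvPolynomial (Fin (1 + 1)) K) ∈ HomogeneousIdeal.irrelevant (MvPolynomial.homogeneousSubmodule (Fin (1 + 1)) K) :=
          HomogeneousIdeal.mem_irrelevant_of_mem _ zero_lt_one (ProjectiveSpace.X_mem (R := K) (0 : Fin (1 + 1)))
        have h0 : (X 0 : MvPolynomial (Fin (1 + 1)) K) ∈ (⊥ : HomogeneousIdeal (MvPolynomial.homogeneousSubmodule (Fin (1 + 1)) K)) := h hX
        rw [← HomogeneousIdeal.mem_iff, HomogeneousIdeal.toIdeal_bot, Ideal.mem_bot] at h0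
        exact X_ne_zero (R := K) (0 : Fin (1 + 1)) h0⟩
    refine ⟨y₀, ?_⟩
    apply ProjectiveSpectrum.ext
    apply HomogeneousIdeal.toIdeal_injective
    rw [EquisingularLiftNat.LinearCentre.projMap_apply_asHomogeneousIdeal, HomogeneousIdeal.toIdeal_comap,
      Literature.AlgebraicGeometry.Motives.toIdeal_coordSubspacePoint]
    change Ideal.comap fk.toRingHom ⊥ = _
    rw [← RingHom.ker_eq_comap_bot,
      EquisingularLift.StrataSplit.LinearCentre.ker_kill (r := 1) (m := m) fk.toRingHom (fun a => hfkC a) (fun i => hfkX i)]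
    congr 1
    ext i
    simp [hs]

include hfkC hfkX in
/-- **`𝓘⟨Λ⟩ = ker Proj(f_K)`**: the vanishing ideal sheaf of the coordinate line is the kernel ideal sheaf of the kill-map immersion (the source
`ℙ¹` is reduced; tree `ker_eq_vanishingIdeal_of_isReduced`). [cite: Hartshorne1977, II Ex. 3.12] (folklore) -/
theorem ker_projMap_kill_eq_vanishingIdeal_coordLine :
    (Proj.map fk hfk').ker = Scheme.IdealSheafData.vanishingIdeal (⟨_, isClosed_coordLine K m⟩ : Closeds (Proj 𝒜)) := by
  have hsurj : Function.Surjective fk :=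
    EquisingularLift.StrataSplit.LinearCentre.kill_surjective (r := 1) (m := m) fk.toRingHom (fun a => hfkC a) (fun i => hfkX i)
  haveI : IsClosedImmersion (Proj.map fk hfk') :=
    Literature.AlgebraicGeometry.FundamentalGroup.isClosedImmersion_projMap_of_surjective fk hfk' hsurj
  haveI : IsReduced (Proj (MvPolynomial.homogeneousSubmodule (Fin (1 + 1)) K)) := Proj.isReduced _
  rw [Literature.AlgebraicGeometry.Motives.ker_eq_vanishingIdeal_of_isReduced]
  congr 1
  apply Closeds.ext
  exact range_projMap_kill_eq_coordLine K m fk hfk' hfkC hfkX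

end KillIdeal

/-- ★★ **EVERY COORDINATE LINE OF `ℙ^{m+1}_K` HAS UNOBSTRUCTED EMBEDDED DEFORMATIONS**: `DirStepUnobs ℙ^{m+1}_K univ _ Λ` for
`Λ = V₊(x₂, …, x_{m+1})` (`Ȟ¹(Λ̃, 𝒩_{Λ̃/ℙ^{m+1}}) = 0`, `𝒩 = 𝒪(1)^m`; `m = 1`: a line in the plane, `m = 2`: the double line of ℙ³), by the twisted producer
✓ p655133 on the charts `D₊(x₀)`, `D₊(x₁)`. [OURS · L1 W4.5b · EL♮(3) · N-8; NOT a statement of the manuscript; EL♮(3) NOT proved] [cite: Hartshorne1977, III Thm. 5.1] -/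
theorem dirStepUnobs_coordLine :
    DirStepUnobs (Proj 𝒜) Set.univ isClosed_univ
      {y : Proj 𝒜 | ∀ k : Fin m, (X (⟨(k : ℕ) + 2, by omega⟩ : Fin (1 + m + 1)) : A4) ∈ y.asHomogeneousIdeal} (isClosed_coordLine K m) := by
  classical
  obtain ⟨fk, hfk', hfkC, hfkX⟩ := EquisingularLift.StrataSplit.LinearCentre.exists_kill K 1 m
  haveI : IsLocallyNoetherian (Proj 𝒜) := EquisingularLift.StrataSplit.LinearCentre.isLocallyNoetherian_proj K (1 + m)
  haveI : IsReduced (Proj 𝒜) := Proj.isReduced 𝒜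
  have hΛ := ker_projMap_kill_eq_vanishingIdeal_coordLine K m fk hfk' hfkC hfkX
  obtain ⟨hM, hsplit⟩ := transport_of_eq K m fk hfk' hfkC hfkX (V := ((U[0]) : (Proj 𝒜).Opens) ⊓ U[1])
    (by rw [ProjSubscheme.affineBasicOpen_coe, ProjSubscheme.affineBasicOpen_coe, ← Proj.basicOpen_mul])
    (isAffineOpen_inf K m) inf_le_left inf_le_right
  refine dirStepUnobs_univ_of_two_charts (Proj 𝒜) _ (isClosed_coordLine K m) (U[0]) (U[1]) (isAffineOpen_inf K m)
    (coordLine_subset_union K m) (gens[0]) (gens[1]) (isQuasiRegular_gens K m 0) (isQuasiRegular_gens K m 1) ?_ ?_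
    (fun k j => if k = j then (Proj 𝒜).presheaf.map (homOfLE inf_le_left).op (aTS[(X 0 : A4)] (ProjectiveSpace.chartGen K 0 0)) else 0)
    hM ?_
  · rw [← hΛ]; exact span_gens_eq K m fk hfk' hfkC hfkX 0 (fun k => (succAbove_succ_eq m k).1)
  · rw [← hΛ]; exact span_gens_eq K m fk hfk' hfkC hfkX 1 (fun k => (succAbove_succ_eq m k).2)
  · rw [← hΛ]; exact hsplit

end PnLine

end Summit.ResolutionOfSingularities.ResolutionOfSingularities.Cruxes.EquisingularLiftNat.Sections

end
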